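import Literature.AlgebraicGeometry.Frobenioids.ArithmeticFrobenioids
import Literature.AlgebraicGeometry.Frobenioids.FinSubextCatDivSlim
import Literature.AlgebraicGeometry.Frobenioids.FinSubextCatFrobeniusSlim
import Literature.AlgebraicGeometry.Frobenioids.ArithmeticDivisorsFunctor
import Literature.AlgebraicGeometry.Frobenioids.ArithmeticFrobenioidModel
import Literature.AlgebraicGeometry.Frobenioids.ArithmeticFrobenioidDivSlim
import HarnessLib

/-!
# Frobenioids I, §6: Theorem 6.4 (i) (base-category part) — PROOFS

Mochizuki, *The geometry of Frobenioids I*, Kyushu J. Math. **62** (2008), kurims text p. 114 (Thm. 6.4 (i):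
"`D` is Frobenius-slim and Div-slim [with respect to `Φ`, `Φ^pf`, `Φ^rlf`]. Moreover, `D` is slim if and only
if the subgroup of elements of `G` that commute with some open subgroup of `G` is trivial"), proof p. 115.
[cite: MochizukiFrdI2008, Thm. 6.4 (i) p.114]

PROOF-ONLY companion of abc-iut-L1-t3's `ArithmeticFrobenioids.lean` (discharge seat abc-iut-L6-t10, D-ζ-c);
no statement of that file is restated or altered. Results:
* `Thm64i_base_iff_isDivSlim`: the named statement `Thm64i_base M` is EQUIVALENT to its Div-slim conjunct —
  the other two conjuncts (Frobenius-slim; slim ⟺ `Z = {1}`) are PROVED outright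
  (`FinSubextCat.isFrobeniusSlim`, `FinSubextCat.isSlim_iff`);
* `ArithModelFrobenioid.isDivSlim_iff_movesGalois`: the Div-slim conjunct, for the interface operations
  `M.ops`, is equivalent — modulo injectivity of divisor pull-back along morphisms of `D`
  (`FinSubextCat.PullInjective`, true in the model but not a field of the interface: FINDING F3 to
  abc-iut-L1-t3) — to "every `1 ≠ z ∈ Z` acts nontrivially on some `Φ(L)`, `L` finite Galois" (p. 112); the
  remaining arithmetic input is the classical fact quoted on p. 115 ("any automorphism of a number field that
  fixes all of the valuations of the number field is clearly equal to the identity automorphism") — PROVED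
  in the tree for finite places as `Literature.NumberTheory.NumberFields.exists_map_heightOneSpectrum_ne`
  (`NumberFields/AutomorphismMovesPrime.lean`) — but the interface `ArithModelFrobenioid` (no naturality of
  `monEquiv` with respect to the Galois action on arithmetic divisors) cannot transport it to `M.ops.pull`;
  hence `Thm64i_base_of_pullInjective` takes the transported form as the hypothesis `MovesSomeGalois M.ops`.
Lemma 6.5 (ii) is PROVED in `LogPrimesTranscendenceProofs.lean` (`Lemma65ii_holds`).
-/

noncomputable section

namespace Literature.AlgebraicGeometry.Frobenioids

open CategoryTheory

universe u v

/-! ### Theorem 6.4 (i), base-category part -/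

section Thm64

variable {F : Type} [Field F] [NumberField F] {K : Type} [Field K] [Algebra F K] [IsGalois F K]
variable {C : Type u} [Category.{v} C] (M : ArithModelFrobenioid F K C)

/-- **Theorem 6.4 (i)**, base part — two of its three conjuncts PROVED: the named statement `Thm64i_base M`
("`D` is Frobenius-slim and Div-slim, and slim iff `Z = {1}`", FrdI p. 114) holds iff its Div-slim conjunct
does. [cite: MochizukiFrdI2008, Thm. 6.4 (i) p.114] -/
theorem Thm64i_base_iff_isDivSlim : Thm64i_base M ↔ M.ops.IsDivSlim :=
  ⟨fun h => h.2.1, fun h => ⟨FinSubextCat.isFrobeniusSlim F K, h, FinSubextCat.isSlim_iff F K⟩⟩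

/-- The Div-slim criterion of FrdI p. 112 for the arithmetic operations, modulo injectivity of divisor
pull-back (`FinSubextCat.PullInjective`; FINDING F3): `D` is Div-slim w.r.t. `Φ` iff every `1 ≠ z ∈ Z`
acts nontrivially on `Φ(L)` for some finite Galois `L ⊆ K` over `F`.
[cite: MochizukiFrdI2008, Thm. 6.4 (i) p.114] -/
theorem ArithModelFrobenioid.isDivSlim_iff_movesGalois (hinj : FinSubextCat.PullInjective M.ops) :
    M.ops.IsDivSlim ↔ FinSubextCat.MovesSomeGalois M.ops :=
  ⟨fun h => FinSubextCat.movesGalois_of_aut_eq_one hinj h.eq_one,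
    fun h => ⟨FinSubextCat.aut_eq_one_of_movesGalois hinj h⟩⟩

/-- **Theorem 6.4 (i)**, base part, PROVED modulo the two inputs the interface cannot supply (FINDING F3):
injectivity of divisor pull-back and "a nontrivial `z ∈ Z` moves some arithmetic divisor of some finite
Galois `L`" (p. 115: "any automorphism of a number field that fixes all of the valuations … is … the
identity"). [cite: MochizukiFrdI2008, Thm. 6.4 (i) p.114] -/
theorem Thm64i_base_of_pullInjective (hinj : FinSubextCat.PullInjective M.ops)
    (hmoves : FinSubextCat.MovesSomeGalois M.ops) : Thm64i_base M :=
  (Thm64i_base_iff_isDivSlim M).mpr ((ArithModelFrobenioid.isDivSlim_iff_movesGalois M hinj).mpr hmoves)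

end Thm64

/-! ### Example 6.3: the divisor monoid on `D` — abc-iut-L1-t3's interface CONSTRUCTED -/

section Ex63

variable (F : Type) [Field F] [NumberField F] (K : Type) [Field K] [Algebra F K]

/-- **Example 6.3, CONSTRUCTED** (FrdI p. 113: "`Φ`, `B`, as well as `B → Φ^gp` are functorial"): the
interface `ArithDivisorMonoidOn F K` of `ArithmeticFrobenioids.lean` (pull-backs of effective arithmetic
divisors along the arrows of `D`, functorial and compatible with principal divisors) instantiated by the
pull-back `EffArithDivisor.pullback` of `ArithmeticDivisorsFunctor.lean` (finite places: coefficient ×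
ramification index; archimedean places: restriction). [cite: MochizukiFrdI2008, Ex. 6.3 p.113] -/
def arithDivisorMonoidOn : ArithDivisorMonoidOn F K where
  pull σ := AddMonoidHom.toMultiplicative (EffArithDivisor.pullback σ.toAlgHom.toRingHom)
  pull_id _ x := congrArg Multiplicative.ofAdd (EffArithDivisor.pullback_id (Multiplicative.toAdd x))
  pull_comp _ _ x :=
    congrArg Multiplicative.ofAdd (EffArithDivisor.pullback_comp _ _ (Multiplicative.toAdd x))
  pull_div σ f D E h := EffArithDivisor.pullback_sub_eq_principal σ.toAlgHom.toRingHom f D E h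

/-- The constructed pull-back is the one of `ArithmeticDivisorsFunctor.lean` (unfolding).
[cite: MochizukiFrdI2008, Ex. 6.3 p.113] -/
@[simp] theorem arithDivisorMonoidOn_pull {X Y : FinSubextCat F K} (σ : Y ⟶ X)
    (x : Multiplicative (EffArithDivisor X.L)) :
    (arithDivisorMonoidOn F K).pull σ x =
      Multiplicative.ofAdd (EffArithDivisor.pullback σ.toAlgHom.toRingHom (Multiplicative.toAdd x)) := rfl

/-- **Example 6.3 / Theorem 6.4, CONSTRUCTED**: the arithmetic model Frobenioid `C_{K/F}`
(`ArithmeticFrobenioidModel.lean`: t2's `ModelFrobenioid` of `(Φ, B, B → Φ^gp)` over `D`) packaged as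
abc-iut-L1-t3's `ArithModelFrobenioid F K` — its operations are `PreFrobenioidData.ofModel`, and `Φ(Spec L)` IS
`Multiplicative (EffArithDivisor L)` (`monEquiv = refl`). This binds the parameter `M` of `Thm64i_frobenioid`,
`Thm64i_base`, `Thm64iii`, `Thm64iv`. [cite: MochizukiFrdI2008, Thm. 6.4 p.114] -/
def arithModelFrobenioid : ArithModelFrobenioid F K (arithFrobenioid F K) where
  ops := arithFrobenioidOps F K
  monEquiv _ := MulEquiv.refl _

/-- The operations of the constructed model are `arithFrobenioidOps` (unfolding).
[cite: MochizukiFrdI2008, Thm. 6.4 p.114] -/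
@[simp] theorem arithModelFrobenioid_ops : (arithModelFrobenioid F K).ops = arithFrobenioidOps F K := rfl

/-- **Theorem 6.4 (i)**, "not of group-like type" — PROVED for the constructed `C_{K/F}` ("`Φ` is nonzero [so
`C` is not of group-like type]", FrdI p. 115): the object `(Spec F, 0)` carries the nonzero effective divisor
with coordinate `1` at every archimedean place. [cite: MochizukiFrdI2008, Thm. 6.4 (i) p.115] -/
theorem not_isOfGroupLikeType_arith : ¬ (arithFrobenioidOps F K).IsOfGroupLikeType := by
  intro h
  haveI : NumberField (⊥ : IntermediateField F K) := NumberField.of_module_finite F _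
  obtain ⟨w⟩ := (inferInstance : Nonempty (NumberField.InfinitePlace (⊥ : IntermediateField F K)))
  let D : EffArithDivisor (⊥ : IntermediateField F K) := (0, fun _ => 1)
  have h1 := h.obj ⟨⟨⊥⟩, 1⟩ (Multiplicative.ofAdd D)
  have hD : D = 0 := Multiplicative.ofAdd.injective h1
  have h2 : D.2 w = 0 := by rw [hD]; rfl
  exact one_ne_zero h2

variable [IsGalois F K]

/-- **Theorem 6.4 (i): "`D` is Div-slim [with respect to `Φ`]"** — PROVED for the constructed `C_{K/F}`
(Def. 4.5 (iv), abc-iut-L1-t3's `PreFrobenioidData.IsDivSlim`), from `ArithmeticFrobenioidDivSlim.lean`.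
[cite: MochizukiFrdI2008, Thm. 6.4 (i) p.114] -/
theorem arithFrobenioidOps_isDivSlim : (arithFrobenioidOps F K).IsDivSlim :=
  ⟨fun A α hα => aut_eq_one_arith F K A α hα⟩

/-- **Theorem 6.4 (i), base-category part — PROVED IN FULL for the constructed arithmetic model Frobenioid
`C_{K/F}`**: "`D` is Frobenius-slim and Div-slim [with respect to `Φ`] … `D` is slim if and only if the subgroup
of elements of `G` that commute with some open subgroup of `G` is trivial" (FrdI p. 114) — the named statement
`Thm64i_base` of abc-iut-L1-t3 at `M := arithModelFrobenioid F K`, unconditionally.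
[cite: MochizukiFrdI2008, Thm. 6.4 (i) p.114] -/
theorem Thm64i_base_arith : Thm64i_base (arithModelFrobenioid F K) :=
  (Thm64i_base_iff_isDivSlim (arithModelFrobenioid F K)).mpr (arithFrobenioidOps_isDivSlim F K)

end Ex63

end Literature.AlgebraicGeometry.Frobenioids

end
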